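import Summits.QuantumFields.YangMills.Theorems.PoincareLipschitzBlowDownWeakGradientLetters
import Summits.QuantumFields.YangMills.Theorems.PoincareLipschitzBlowDownCells
import Summits.QuantumFields.YangMills.Theorems.PoincareLipschitzSamplingCells
import HarnessLib

/-!
# Crux `HistoryTailL` (stmt-QuantumFields-19936) ∕ K2 crux `BlockLipschitzL` (stmt-QuantumFields-23533), LINE 25 «CompactnessTransfer» v1.4 —
# FILE (Γ2-IBP) «THE `L²`-LIMIT OF THE BLOW-DOWNS HAS WEAK GRADIENT = THE WEAK LIMIT OF THE RESCALED FORWARD DIFFERENCES»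

Cell `ym3-torus` (YM ladder rung R3 = continuum SU(2) Yang–Mills on T³ — a RUNG, NOT the Clay problem: not d = 4, not infinite volume, not a mass
gap); LEAD seat `ym-ust-19936-w1` g10 (S2♭″ architecture v0, brick (Γ2-IBP)).  Helper `--supports stmt-QuantumFields-19936`; THEOREMS ONLY (0 `def`,
0 `sorry`, default heartbeats; `maxSynthPendingDepth 3` for the nested operator type of lit `smulRightL`, as in lit `WeakDerivInner`).

WHY.  In LINE 25 v1.4 (LEAD words (a) «S1″ PASS», (c) «BAND PASS», 2026-08-29) the continuum fact S1″ and the lattice stub S2♭″ speak the tree's Sobolev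
vocabulary: a map `U` on the open unit cube `Q` WITH A WEAK GRADIENT `G` (lit `SobolevDomain.HasWeakFDerivOn ⟨Q,hQ⟩ volume U G`) and density
`Σ_i ‖G x (single i 1)‖²`.  Γ1 (✓p718508 `stub_blowDownL2Compact`, px3 g7) delivers the `L²(Q)`-limit `U` of the piecewise-constant blow-downs
`x ↦ u k (z k + ⌊R_k x⌋)` of the almost-minimising unit lattice maps and the convergence of the dyadic block means of the rescaled forward differences
`v_{k,μ} x := R_k • (u k (z k + ⌊R_k x⌋ + e_μ) − u k (z k + ⌊R_k x⌋))`; ★w8 g8's (Γ2-W) turns the latter into ONE weak limit `G_μ ∈ L²(Q)` with the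
pairing row `∫_Q φ • v_{k,μ} → ∫_Q φ • G_μ`.  THIS FILE is the remaining bridge: those data force `HasWeakFDerivOn ⟨Q,hQ⟩ volume U (v ↦ Σ_μ v_μ • G_μ)`.

THE ARGUMENT (Evans §5.8.2 Thm 3, with a MOVING function).  The shift identity `⌊R(x + e_μ∕R)⌋ = ⌊Rx⌋ + e_μ` (letters file) makes `v_{k,μ}` EXACTLY the
difference quotient `D^{1∕R_k}_{e_μ}` of the blow-down `w_k`; for `R_k` beyond the cushion of `tsupport φ` inside `Q`, lit ✓`setIntegral_diffQuot_neg_smul_eq`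
(discrete integration by parts) gives `∫_Q φ • v_{k,μ} = −∫_Q (D^{−1∕R_k}_{e_μ} φ) • w_k`; then `D^{−1∕R_k}φ → ∂_μ φ` pointwise and boundedly (dominated
convergence on the finite-volume cube) while `w_k → U` in `L¹(Q)` (from `L²`, letters file), so the right side tends to `−∫_Q (∂_μφ) • U`; uniqueness
of limits.  The three directions assemble by expanding `v` in the standard basis.

WHAT IS PROVED (ns `…Theorems.PoincareLipschitzBlowDownWeakGradient`).
* ★★ `setIntegral_fderiv_single_smul_eq` — the per-direction identity `∫_Q (∂_μ φ) • U = −∫_Q φ • G_μ` for every test function `φ` on `Q`.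
* ★★★ `hasWeakFDerivOn_of_blowDown_pairings` — (Γ2-IBP) as displayed in the title: hypotheses = Γ1's (c3) row VERBATIM + `G_μ` integrable on `Q` + the
  test-function pairing row; conclusion `HasWeakFDerivOn ⟨Q,hQ⟩ volume U (fun x => Σ_μ (EuclideanSpace.proj μ).smulRight (G_μ x))`.
* ★★★ `hasWeakFDerivOn_of_blowDown_pairings_subseq` — the same along Γ1's extracted subsequence `φ` (the knit's `hIBP` row).
HONEST SCOPE.  One measure-theoretic brick of S2♭″; Γ2-W, Γ2-lsc, Γ5, the knit, S1″, `hHalvingBand`, K1, `MeanDeviationL`, `BlockLipschitzL`, `HistoryTailL`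
are NOT proved here.  YM₃ on T³ is rung R3, not Clay; YM gap NOT proved; no summit statement is proved here.

References: L. C. Evans, Partial Differential Equations (2010) §5.8.2 Thm 3 [Evans2010]; S. Luckhaus, Indiana Univ. Math. J. 37 (1988) 349–367; R. Alicandro,
M. Cicalese, SIAM J. Math. Anal. 2008 [AlicandroCicalese2008].
-/

set_option autoImplicit false

-- nested operator types `(E →L[ℝ] ℝ) →L[ℝ] F →L[ℝ] E →L[ℝ] F` (`smulRightL`), as in lit `WeakDerivInner`
set_option maxSynthPendingDepth 3

noncomputable section

open scoped BigOperators ENNReal Topology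
open MeasureTheory Set Filter

namespace Summit.QuantumFields.YangMills.Theorems.PoincareLipschitzBlowDownWeakGradient

open Literature.MathematicalPhysics.QuantumFieldTheory.Balaban1983to89
open B4Eq19LatticeOperators (Zd box unitVec)
open Literature.Analysis.FunctionSpaces
open Summit.QuantumFields.YangMills.Theorems.PoincareLipschitzBlowDownCells (aestronglyMeasurable_comp_floorVec)
open Summit.QuantumFields.YangMills.Theorems.PoincareLipschitzSamplingCells (absCube_subset_closedBall)
open Summit.QuantumFields.YangMills.Theorems.PoincareLipschitzBlowDownWeakGradientLetters

/-! ## §1 The per-direction identity `∫_Q (∂_μ φ) • U = -∫_Q φ • G_μ` -/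

/-- ★★ **PER-DIRECTION WEAK-GRADIENT IDENTITY.**  Let `u k : ℤ³ → S³ ⊂ ℝ⁴` be unit lattice maps, `z k` centres, `R k ≥ k + 1` radii, and let the
piecewise-constant blow-downs `x ↦ u k (z k + ⌊R_k x⌋)` converge to `U` in `L²` of the open unit cube `Q` (`U` a.e.-strongly measurable with `‖U‖ ≤ 1` a.e.
there).  Fix a lattice direction `μ`.  If the rescaled forward differences `R_k • (u k (z k + ⌊R_k x⌋ + e_μ) − u k (z k + ⌊R_k x⌋))` tested against every
test function `φ` on `Q` converge to `∫_Q φ • G_μ` for some `G_μ` integrable on `Q`, then `∫_Q (∂_μ φ) • U = -∫_Q φ • G_μ` for every test function `φ`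
(`∂_μ φ x = fderiv ℝ φ x e_μ`, `e_μ = EuclideanSpace.single μ 1`).  Proof: the shift identity `⌊R(x + e_μ∕R)⌋ = ⌊Rx⌋ + e_μ` makes the rescaled difference
the difference quotient `D^{1∕R}_{e_μ}` of the blow-down; discrete integration by parts (lit ✓`setIntegral_diffQuot_neg_smul_eq`) moves it onto `φ`;
`D^{-1∕R}_{e_μ} φ → ∂_μ φ` boundedly and pointwise while the blow-downs converge in `L¹(Q)`. [cite: Evans2010, §5.8.2 Theorem 3] -/
theorem setIntegral_fderiv_single_smul_eq
    (hQ : IsOpen {x : EuclideanSpace ℝ (Fin 3) | ∀ i : Fin 3, |x i| < 1})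
    (u : ℕ → Zd 3 → EuclideanSpace ℝ (Fin 4)) (z : ℕ → Zd 3) (R : ℕ → ℤ)
    (hR : ∀ k : ℕ, (k : ℝ) + 1 ≤ R k) (hu : ∀ (k : ℕ) (y : Zd 3), ‖u k y‖ = 1)
    (U : EuclideanSpace ℝ (Fin 3) → EuclideanSpace ℝ (Fin 4))
    (hUm : AEStronglyMeasurable U (volume.restrict {x : EuclideanSpace ℝ (Fin 3) | ∀ i : Fin 3, |x i| < 1}))
    (hU1 : ∀ᵐ x ∂(volume.restrict {x : EuclideanSpace ℝ (Fin 3) | ∀ i : Fin 3, |x i| < 1}), ‖U x‖ ≤ 1)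
    (hL2 : Tendsto (fun k : ℕ => ∫ x in {x : EuclideanSpace ℝ (Fin 3) | ∀ i : Fin 3, |x i| < 1},
        ‖u k (z k + fun i => ⌊(R k : ℝ) * x i⌋) - U x‖ ^ 2) atTop (𝓝 0))
    (μ : Fin 3) (Gμ : EuclideanSpace ℝ (Fin 3) → EuclideanSpace ℝ (Fin 4))
    (hpairμ : ∀ (φ : EuclideanSpace ℝ (Fin 3) → ℝ),
      IsTestFunctionOn ⟨{x : EuclideanSpace ℝ (Fin 3) | ∀ i : Fin 3, |x i| < 1}, hQ⟩ φ →
      Tendsto (fun k : ℕ => ∫ x in {x : EuclideanSpace ℝ (Fin 3) | ∀ i : Fin 3, |x i| < 1},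
          φ x • ((R k : ℝ) • (u k ((z k + fun i => ⌊(R k : ℝ) * x i⌋) + unitVec μ) - u k (z k + fun i => ⌊(R k : ℝ) * x i⌋))))
        atTop (𝓝 (∫ x in {x : EuclideanSpace ℝ (Fin 3) | ∀ i : Fin 3, |x i| < 1}, φ x • Gμ x)))
    (φ : EuclideanSpace ℝ (Fin 3) → ℝ) (hφ : IsTestFunctionOn ⟨{x : EuclideanSpace ℝ (Fin 3) | ∀ i : Fin 3, |x i| < 1}, hQ⟩ φ) :
    ∫ x in {x : EuclideanSpace ℝ (Fin 3) | ∀ i : Fin 3, |x i| < 1}, (fderiv ℝ φ x (EuclideanSpace.single μ (1:ℝ))) • U x =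
      -∫ x in {x : EuclideanSpace ℝ (Fin 3) | ∀ i : Fin 3, |x i| < 1}, φ x • Gμ x := by
  set Q : Set (EuclideanSpace ℝ (Fin 3)) := {x | ∀ i : Fin 3, |x i| < 1} with hQdef
  have hQfin : volume Q < ∞ :=
    lt_of_le_of_lt (measure_mono fun x hx => absCube_subset_closedBall zero_le_one (fun i => (hx i).le))
      (measure_closedBall_lt_top (x := (0 : EuclideanSpace ℝ (Fin 3))) (r := 2 * 1))
  haveI : IsFiniteMeasure (volume.restrict Q) := ⟨by rw [Measure.restrict_apply_univ]; exact hQfin⟩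
  set e : EuclideanSpace ℝ (Fin 3) := EuclideanSpace.single μ (1:ℝ) with he
  have he1 : ‖e‖ = 1 := by
    rw [he]
    simp
  set t : ℕ → ℝ := fun k => ((R k : ℝ))⁻¹ with htdef
  set w : ℕ → EuclideanSpace ℝ (Fin 3) → EuclideanSpace ℝ (Fin 4) := fun k x => u k (z k + fun i => ⌊(R k : ℝ) * x i⌋) with hwdef
  have hRpos : ∀ k, (0:ℝ) < R k := fun k => by
    have h1 := hR k
    have h2 : (0:ℝ) ≤ k := Nat.cast_nonneg k
    linarith
  have hRne : ∀ k, (R k : ℝ) ≠ 0 := fun k => (hRpos k).ne'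
  have ht0 : ∀ k, t k ≠ 0 := fun k => inv_ne_zero (hRne k)
  have htpos : ∀ k, 0 < t k := fun k => inv_pos.2 (hRpos k)
  have ht : Tendsto t atTop (𝓝 0) := by
    have h1 : Tendsto (fun k : ℕ => (R k : ℝ)) atTop atTop := by
      refine tendsto_atTop_mono (fun k => hR k) ?_
      exact tendsto_atTop_add_const_right _ 1 tendsto_natCast_atTop_atTop
    exact tendsto_inv_atTop_zero.comp h1
  -- measurability / integrability of the blow-downs
  have hwm : ∀ k, AEStronglyMeasurable (w k) (volume.restrict Q) := fun k =>
    aestronglyMeasurable_comp_floorVec (fun y => u k (z k + y)) (R k) _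
  have hw1 : ∀ k x, ‖w k x‖ = 1 := fun k x => hu k _
  have hwint : ∀ k, IntegrableOn (w k) Q volume := fun k =>
    integrable_of_norm_le (hwm k) 1 (Eventually.of_forall fun x => (hw1 k x).le)
  -- the shift identity and the difference quotient of the blow-down
  have hshiftId : ∀ k x, w k (x + t k • e) = u k ((z k + fun i => ⌊(R k : ℝ) * x i⌋) + unitVec μ) := by
    intro k x
    show u k (z k + fun i => ⌊(R k : ℝ) * (x + ((R k : ℝ))⁻¹ • EuclideanSpace.single μ (1:ℝ)) i⌋) = _
    rw [floorVec_add_inv_smul_single (hRne k) x μ, add_assoc]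
  have hdq : ∀ k x, diffQuot e (t k) (w k) x =
      (R k : ℝ) • (u k ((z k + fun i => ⌊(R k : ℝ) * x i⌋) + unitVec μ) - u k (z k + fun i => ⌊(R k : ℝ) * x i⌋)) := by
    intro k x
    rw [diffQuot_apply, hshiftId]
    show ((R k : ℝ))⁻¹⁻¹ • _ = _
    rw [inv_inv]
  have hwint' : ∀ k, IntegrableOn (fun x => w k (x + t k • e)) Q volume := by
    intro k
    have : (fun x => w k (x + t k • e)) = fun x => u k ((z k + fun i => ⌊(R k : ℝ) * x i⌋) + unitVec μ) :=
      funext (hshiftId k)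
    rw [this]
    exact integrable_of_norm_le (aestronglyMeasurable_comp_floorVec (fun y => u k ((z k + y) + unitVec μ)) (R k) _) 1
      (Eventually.of_forall fun x => (hu k _).le)
  -- a compact cushion around the support of `φ` inside `Q`
  set K : Set (EuclideanSpace ℝ (Fin 3)) := tsupport φ with hK
  have hKc : IsCompact K := hφ.hasCompactSupport
  obtain ⟨δ, hδ, hKδ⟩ := hKc.exists_cthickening_subset_open hQ hφ.tsupport_subset
  have hsmall : ∀ᶠ k in atTop, ‖t k • e‖ < δ := by
    have : Tendsto (fun k => ‖t k • e‖) atTop (𝓝 0) := by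
      have := (ht.smul_const e).norm
      simpa using this
    exact (tendsto_order.1 this).2 δ hδ
  have hshift : ∀ {s : ℝ}, ‖s • e‖ < δ → ∀ y ∈ K, y + s • e ∈ Q := fun {s} hs y hy => by
    apply hKδ
    refine Metric.mem_cthickening_of_dist_le (y + s • e) y δ K hy ?_
    rw [dist_eq_norm, add_sub_cancel_left]
    exact hs.le
  -- integrability of the tested products
  have hint : ∀ k, IntegrableOn (fun y => φ y • w k y) Q volume := fun k =>
    integrableOn_smul_of_tsupport_subset (Ω := ⟨Q, hQ⟩) hφ.contDiff.continuous hφ.hasCompactSupport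
      hφ.tsupport_subset (hwint k).locallyIntegrableOn
  have hint' : ∀ k, IntegrableOn (fun y => φ y • w k (y + t k • e)) Q volume := fun k =>
    integrableOn_smul_of_tsupport_subset (Ω := ⟨Q, hQ⟩) hφ.contDiff.continuous hφ.hasCompactSupport
      hφ.tsupport_subset (hwint' k).locallyIntegrableOn
  -- discrete integration by parts, for `k` large
  have hibp : ∀ᶠ k in atTop, ∫ y in Q, (diffQuot e (-(t k)) φ y) • w k y = -∫ y in Q, φ y • diffQuot e (t k) (w k) y := by
    filter_upwards [hsmall] with k hk
    exact setIntegral_diffQuot_neg_smul_eq volume (Ω := ⟨Q, hQ⟩) (A := K) (k := φ) (g := w k) (v := e)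
      (t := t k) (subset_tsupport φ) hφ.tsupport_subset (hshift hk) (hint k) (hint' k)
  -- right-hand side: the tested rescaled differences converge (hypothesis)
  have hRHS : Tendsto (fun k => -∫ y in Q, φ y • diffQuot e (t k) (w k) y) atTop (𝓝 (-∫ x in Q, φ x • Gμ x)) := by
    have h := (hpairμ φ hφ).neg
    refine h.congr' (Eventually.of_forall fun k => ?_)
    simp only [hdq]
    rfl
  -- left-hand side: `∫ (D^{-t}φ) • w_k → ∫ (∂_μ φ) • U`
  have hφ1 : ContDiff ℝ 1 φ := hφ.contDiff.of_le (by exact_mod_cast le_top)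
  have hφd : Differentiable ℝ φ := hφ1.differentiable one_ne_zero
  obtain ⟨L, hL0, hL⟩ := norm_diffQuot_le_of_contDiff hφ1 hφ.hasCompactSupport e
  obtain ⟨L', hL'⟩ := (hφ.hasCompactSupport.fderiv (𝕜 := ℝ)).exists_bound_of_continuous (hφ1.continuous_fderiv one_ne_zero)
  have hL'0 : 0 ≤ L' := (norm_nonneg _).trans (hL' 0)
  have hdφc : ∀ k, Continuous fun y => diffQuot e (-(t k)) φ y := fun k => by
    have hφc : Continuous φ := hφ1.continuous
    simp only [diffQuot]
    fun_prop
  have hDc : Continuous fun y => fderiv ℝ φ y e := (hφ1.continuous_fderiv one_ne_zero).clm_apply continuous_const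
  have hDb : ∀ y, ‖fderiv ℝ φ y e‖ ≤ L' := fun y => by
    calc ‖fderiv ℝ φ y e‖ ≤ ‖fderiv ℝ φ y‖ * ‖e‖ := ContinuousLinearMap.le_opNorm _ _
      _ ≤ L' * 1 := by rw [he1]; exact mul_le_mul_of_nonneg_right (hL' y) zero_le_one
      _ = L' := mul_one _
  -- (i) `∫_Q |D^{-t_k}φ - ∂_μφ| → 0` by dominated convergence
  have hDC : Tendsto (fun k => ∫ y in Q, ‖diffQuot e (-(t k)) φ y - fderiv ℝ φ y e‖) atTop (𝓝 0) := by
    have h := tendsto_integral_of_dominated_convergence (μ := volume.restrict Q) (fun _ => L * ‖e‖ + L')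
      (F := fun k y => ‖diffQuot e (-(t k)) φ y - fderiv ℝ φ y e‖) (f := fun _ => (0:ℝ)) ?_ ?_ ?_ ?_
    · simpa using h
    · exact fun k => ((hdφc k).sub hDc).norm.aestronglyMeasurable
    · exact integrable_const _
    · refine fun k => Eventually.of_forall fun y => ?_
      rw [Real.norm_eq_abs, abs_of_nonneg (norm_nonneg _)]
      exact (norm_sub_le _ _).trans (add_le_add (hL _ _) (hDb y))
    · refine Eventually.of_forall fun y => ?_
      have hderiv : HasLineDerivAt ℝ φ (fderiv ℝ φ y e) y e := (hφd y).hasFDerivAt.hasLineDerivAt e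
      have hslope := HasDerivAt.tendsto_slope_zero hderiv
      simp only [zero_add, zero_smul, add_zero] at hslope
      have hseq : Tendsto (fun k => -(t k)) atTop (𝓝[≠] 0) := by
        refine tendsto_nhdsWithin_iff.2 ⟨by simpa using ht.neg, Eventually.of_forall fun k => ?_⟩
        simpa using ht0 k
      have hconv : Tendsto (fun k => diffQuot e (-(t k)) φ y) atTop (𝓝 (fderiv ℝ φ y e)) := by
        have := hslope.comp hseq
        simpa [diffQuot, Function.comp_def] using this
      have := (tendsto_iff_norm_sub_tendsto_zero.1 hconv)
      simpa using this
  -- (ii) `∫_Q ‖w_k - U‖ → 0`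
  have hL1 : Tendsto (fun k => ∫ x in Q, ‖w k x - U x‖) atTop (𝓝 0) := by
    refine tendsto_setIntegral_norm_of_sq hQfin (fun k => (hwm k).sub hUm) (C := 2) (fun k => ?_) hL2
    filter_upwards [hU1] with x hx
    calc ‖w k x - U x‖ ≤ ‖w k x‖ + ‖U x‖ := norm_sub_le _ _
      _ ≤ 2 := by rw [hw1]; linarith
  -- (iii) assemble the left-hand side
  have hUint : IntegrableOn U Q volume := integrable_of_norm_le hUm 1 hU1
  have hF1 : ∀ k, Integrable (fun y => (diffQuot e (-(t k)) φ y) • w k y) (volume.restrict Q) := fun k =>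
    integrable_of_norm_le ((hdφc k).aestronglyMeasurable.smul (hwm k)) (L * ‖e‖)
      (Eventually.of_forall fun y => by rw [norm_smul, hw1, mul_one]; exact hL _ _)
  have hF2 : Integrable (fun y => (fderiv ℝ φ y e) • U y) (volume.restrict Q) :=
    integrable_of_norm_le (hDc.aestronglyMeasurable.smul hUm) L'
      (by filter_upwards [hU1] with y hy; rw [norm_smul]; nlinarith [hDb y, norm_nonneg (fderiv ℝ φ y e), norm_nonneg (U y)])
  have hF3 : ∀ k, Integrable (fun y => (fderiv ℝ φ y e) • w k y) (volume.restrict Q) := fun k =>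
    integrable_of_norm_le (hDc.aestronglyMeasurable.smul (hwm k)) L'
      (Eventually.of_forall fun y => by rw [norm_smul, hw1, mul_one]; exact hDb y)
  have hLHS : Tendsto (fun k => ∫ y in Q, (diffQuot e (-(t k)) φ y) • w k y) atTop (𝓝 (∫ x in Q, (fderiv ℝ φ x e) • U x)) := by
    refine tendsto_iff_norm_sub_tendsto_zero.2 ?_
    refine squeeze_zero (g := fun k => (∫ y in Q, ‖diffQuot e (-(t k)) φ y - fderiv ℝ φ y e‖) + L' * ∫ x in Q, ‖w k x - U x‖)
      (fun k => norm_nonneg _) (fun k => ?_) ?_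
    · have hsplit : (∫ y in Q, (diffQuot e (-(t k)) φ y) • w k y) - ∫ x in Q, (fderiv ℝ φ x e) • U x =
          (∫ y in Q, (diffQuot e (-(t k)) φ y - fderiv ℝ φ y e) • w k y) + ∫ y in Q, (fderiv ℝ φ y e) • (w k y - U y) := by
        rw [← integral_sub (hF1 k) hF2]
        rw [← integral_add ((hF1 k).sub (hF3 k) |>.congr ?_) ((hF3 k).sub hF2 |>.congr ?_)]
        · refine integral_congr_ae (Eventually.of_forall fun y => ?_)
          simp only [sub_smul, smul_sub]; abel
        · exact Eventually.of_forall fun y => by simp only [Pi.sub_apply, sub_smul]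
        · exact Eventually.of_forall fun y => by simp only [Pi.sub_apply, smul_sub]
      rw [hsplit]
      refine (norm_add_le _ _).trans (add_le_add ?_ ?_)
      · refine (norm_integral_le_integral_norm _).trans (le_of_eq ?_)
        refine integral_congr_ae (Eventually.of_forall fun y => ?_)
        simp only [norm_smul, hw1, mul_one]
      · refine (norm_integral_le_integral_norm _).trans ?_
        rw [← integral_const_mul]
        refine integral_mono_of_nonneg (Eventually.of_forall fun y => norm_nonneg _) ?_ (Eventually.of_forall fun y => ?_)
        · exact ((integrable_of_norm_le ((hwm k).sub hUm) 2 (by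
            filter_upwards [hU1] with x hx
            calc ‖w k x - U x‖ ≤ ‖w k x‖ + ‖U x‖ := norm_sub_le _ _
              _ ≤ 2 := by rw [hw1]; linarith)).norm.const_mul L')
        · simp only [norm_smul]
          exact mul_le_mul_of_nonneg_right (hDb y) (norm_nonneg _)
    · have := hDC.add (hL1.const_mul L')
      simpa using this
  -- conclude: both limits of the same sequence
  have hlim2 : Tendsto (fun k => ∫ y in Q, (diffQuot e (-(t k)) φ y) • w k y) atTop (𝓝 (-∫ x in Q, φ x • Gμ x)) :=
    hRHS.congr' (hibp.mono fun k hk => hk.symm)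
  exact tendsto_nhds_unique hLHS hlim2


/-! ## §2 ★★★ The weak gradient of the blow-down limit -/

/-- ★★★ **(Γ2-IBP) THE `L²`-LIMIT OF THE BLOW-DOWNS HAS WEAK GRADIENT = THE WEAK LIMIT OF THE RESCALED FORWARD DIFFERENCES.**  Hypotheses: Γ1's
(c3) row VERBATIM for `(u, z, R, U)` (unit lattice maps, `R k ≥ k + 1`, `U` a.e.-strongly measurable with `‖U‖ ≤ 1` a.e. on the open unit cube `Q`, the
piecewise-constant blow-downs `x ↦ u k (z k + ⌊R_k x⌋)` converge to `U` in `L²(Q)`), and for each lattice direction `μ` a function `G_μ` integrable on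
`Q` onto which the rescaled forward differences `R_k • (u k (z k + ⌊R_k x⌋ + e_μ) − u k (z k + ⌊R_k x⌋))` converge when tested against test functions
on `Q` (the (Γ2-W) pairing row).  Conclusion: `U` has the weak (Fréchet) gradient `x ↦ (v ↦ Σ_μ v_μ • G_μ x)` on `Q` in the sense of lit
`HasWeakFDerivOn` — the `W^{1,2}` vocabulary of LINE 25 v1.4 (S1″∕S2♭″); by `sum_smulRight_apply_single` its density letter is `Σ_i ‖G_i x‖²`.
[cite: Evans2010, §5.8.2 Theorem 3] -/
theorem hasWeakFDerivOn_of_blowDown_pairings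
    (hQ : IsOpen {x : EuclideanSpace ℝ (Fin 3) | ∀ i : Fin 3, |x i| < 1})
    (u : ℕ → Zd 3 → EuclideanSpace ℝ (Fin 4)) (z : ℕ → Zd 3) (R : ℕ → ℤ)
    (hR : ∀ k : ℕ, (k : ℝ) + 1 ≤ R k) (hu : ∀ (k : ℕ) (y : Zd 3), ‖u k y‖ = 1)
    (U : EuclideanSpace ℝ (Fin 3) → EuclideanSpace ℝ (Fin 4))
    (hUm : AEStronglyMeasurable U (volume.restrict {x : EuclideanSpace ℝ (Fin 3) | ∀ i : Fin 3, |x i| < 1}))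
    (hU1 : ∀ᵐ x ∂(volume.restrict {x : EuclideanSpace ℝ (Fin 3) | ∀ i : Fin 3, |x i| < 1}), ‖U x‖ ≤ 1)
    (hL2 : Tendsto (fun k : ℕ => ∫ x in {x : EuclideanSpace ℝ (Fin 3) | ∀ i : Fin 3, |x i| < 1},
        ‖u k (z k + fun i => ⌊(R k : ℝ) * x i⌋) - U x‖ ^ 2) atTop (𝓝 0))
    (G : Fin 3 → EuclideanSpace ℝ (Fin 3) → EuclideanSpace ℝ (Fin 4))
    (hG : ∀ μ : Fin 3, IntegrableOn (G μ) {x : EuclideanSpace ℝ (Fin 3) | ∀ i : Fin 3, |x i| < 1} volume)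
    (hpair : ∀ (μ : Fin 3) (φ : EuclideanSpace ℝ (Fin 3) → ℝ),
      IsTestFunctionOn ⟨{x : EuclideanSpace ℝ (Fin 3) | ∀ i : Fin 3, |x i| < 1}, hQ⟩ φ →
      Tendsto (fun k : ℕ => ∫ x in {x : EuclideanSpace ℝ (Fin 3) | ∀ i : Fin 3, |x i| < 1},
          φ x • ((R k : ℝ) • (u k ((z k + fun i => ⌊(R k : ℝ) * x i⌋) + unitVec μ) - u k (z k + fun i => ⌊(R k : ℝ) * x i⌋))))
        atTop (𝓝 (∫ x in {x : EuclideanSpace ℝ (Fin 3) | ∀ i : Fin 3, |x i| < 1}, φ x • G μ x))) :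
    HasWeakFDerivOn ⟨{x : EuclideanSpace ℝ (Fin 3) | ∀ i : Fin 3, |x i| < 1}, hQ⟩ volume U
      (fun x => ∑ μ : Fin 3, (EuclideanSpace.proj μ).smulRight (G μ x)) := by
  set Q : Set (EuclideanSpace ℝ (Fin 3)) := {x | ∀ i : Fin 3, |x i| < 1} with hQdef
  have hQfin : volume Q < ∞ :=
    lt_of_le_of_lt (measure_mono fun x hx => absCube_subset_closedBall zero_le_one (fun i => (hx i).le))
      (measure_closedBall_lt_top (x := (0 : EuclideanSpace ℝ (Fin 3))) (r := 2 * 1))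
  haveI : IsFiniteMeasure (volume.restrict Q) := ⟨by rw [Measure.restrict_apply_univ]; exact hQfin⟩
  have hUint : IntegrableOn U Q volume := integrable_of_norm_le hUm 1 hU1
  -- integrability of the bundled gradient on `Q`
  have hG1 : ∀ μ : Fin 3, IntegrableOn (fun x =>
      ((EuclideanSpace.proj μ : EuclideanSpace ℝ (Fin 3) →L[ℝ] ℝ)).smulRight (G μ x)) Q volume := by
    intro μ
    refine Integrable.mono' ((hG μ).norm.const_mul ‖(EuclideanSpace.proj μ : EuclideanSpace ℝ (Fin 3) →L[ℝ] ℝ)‖) ?_ ?_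
    · exact (ContinuousLinearMap.smulRightL ℝ (EuclideanSpace ℝ (Fin 3)) (EuclideanSpace ℝ (Fin 4))
        (EuclideanSpace.proj μ : EuclideanSpace ℝ (Fin 3) →L[ℝ] ℝ)).continuous.comp_aestronglyMeasurable
        (hG μ).aestronglyMeasurable
    · exact Eventually.of_forall fun x => (ContinuousLinearMap.norm_smulRight_apply _ _).le
  have hGint : IntegrableOn (fun x => ∑ μ : Fin 3,
      ((EuclideanSpace.proj μ : EuclideanSpace ℝ (Fin 3) →L[ℝ] ℝ)).smulRight (G μ x)) Q volume := by
    simp only [Fin.sum_univ_three]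
    exact ((hG1 0).add (hG1 1)).add (hG1 2)
  refine ⟨hUint.locallyIntegrableOn, hGint.locallyIntegrableOn, fun φ v hφ => ?_⟩
  -- expand `v` in the standard basis and reduce to the three directions
  have hper : ∀ μ : Fin 3, ∫ x in Q, (fderiv ℝ φ x (EuclideanSpace.single μ (1:ℝ))) • U x = -∫ x in Q, φ x • G μ x :=
    fun μ => setIntegral_fderiv_single_smul_eq hQ u z R hR hu U hUm hU1 hL2 μ (G μ) (hpair μ) φ hφ
  have hv : v = ∑ μ : Fin 3, v μ • EuclideanSpace.single μ (1:ℝ) := by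
    simpa using ((EuclideanSpace.basisFun (Fin 3) ℝ).sum_repr v).symm
  have hlhs : ∀ x, (fderiv ℝ φ x v) • U x = ∑ μ : Fin 3, v μ • ((fderiv ℝ φ x (EuclideanSpace.single μ (1:ℝ))) • U x) := by
    intro x
    conv_lhs => rw [hv]
    rw [map_sum, Finset.sum_smul]
    refine Finset.sum_congr rfl fun μ _ => ?_
    rw [map_smul, smul_eq_mul, mul_smul]
  have hrhs : ∀ x, φ x • (∑ μ : Fin 3, (EuclideanSpace.proj μ).smulRight (G μ x)) v = ∑ μ : Fin 3, v μ • (φ x • G μ x) := by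
    intro x
    rw [sum_smulRight_apply, Finset.smul_sum]
    refine Finset.sum_congr rfl fun μ _ => ?_
    rw [smul_comm]
  -- integrability of the summands
  obtain ⟨L', hL'⟩ := (hφ.hasCompactSupport.fderiv (𝕜 := ℝ)).exists_bound_of_continuous
    ((hφ.contDiff.of_le (by exact_mod_cast le_top) : ContDiff ℝ 1 φ).continuous_fderiv one_ne_zero)
  have hDc : ∀ μ : Fin 3, Continuous fun y => fderiv ℝ φ y (EuclideanSpace.single μ (1:ℝ)) := fun μ =>
    (((hφ.contDiff.of_le (by exact_mod_cast le_top) : ContDiff ℝ 1 φ)).continuous_fderiv one_ne_zero).clm_apply continuous_const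
  have hI1 : ∀ μ : Fin 3, Integrable (fun x => (fderiv ℝ φ x (EuclideanSpace.single μ (1:ℝ))) • U x) (volume.restrict Q) := by
    intro μ
    refine integrable_of_norm_le ((hDc μ).aestronglyMeasurable.smul hUm) (L' * ‖EuclideanSpace.single μ (1:ℝ)‖) ?_
    filter_upwards [hU1] with y hy
    rw [norm_smul]
    have h1 : ‖fderiv ℝ φ y (EuclideanSpace.single μ (1:ℝ))‖ ≤ L' * ‖EuclideanSpace.single μ (1:ℝ)‖ :=
      (ContinuousLinearMap.le_opNorm _ _).trans (mul_le_mul_of_nonneg_right (hL' y) (norm_nonneg _))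
    have h0 : 0 ≤ L' * ‖EuclideanSpace.single μ (1:ℝ)‖ := le_trans (norm_nonneg _) h1
    nlinarith [norm_nonneg (fderiv ℝ φ y (EuclideanSpace.single μ (1:ℝ))), norm_nonneg (U y)]
  have hI2 : ∀ μ : Fin 3, Integrable (fun x => φ x • G μ x) (volume.restrict Q) := fun μ =>
    integrableOn_smul_of_tsupport_subset (Ω := ⟨Q, hQ⟩) hφ.contDiff.continuous hφ.hasCompactSupport
      hφ.tsupport_subset (hG μ).locallyIntegrableOn
  -- assemble
  show ∫ x in Q, (fderiv ℝ φ x v) • U x = -∫ x in Q, φ x • (∑ μ : Fin 3, (EuclideanSpace.proj μ).smulRight (G μ x)) v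
  simp_rw [hlhs, hrhs]
  have hs1 : ∫ x in Q, ∑ μ : Fin 3, v μ • ((fderiv ℝ φ x (EuclideanSpace.single μ (1:ℝ))) • U x) =
      ∑ μ : Fin 3, ∫ x in Q, v μ • ((fderiv ℝ φ x (EuclideanSpace.single μ (1:ℝ))) • U x) :=
    integral_finsetSum _ fun μ _ => (hI1 μ).smul (v μ)
  have hs2 : ∫ x in Q, ∑ μ : Fin 3, v μ • (φ x • G μ x) = ∑ μ : Fin 3, ∫ x in Q, v μ • (φ x • G μ x) :=
    integral_finsetSum _ fun μ _ => (hI2 μ).smul (v μ)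
  rw [hs1, hs2, ← Finset.sum_neg_distrib]
  refine Finset.sum_congr rfl fun μ _ => ?_
  rw [integral_smul, integral_smul, hper μ, smul_neg]


/-- ★★★ **(Γ2-IBP) ALONG A SUBSEQUENCE** — the same bridge with Γ1's extracted `φ` displayed (the knit's `hIBP` row, px3 g8 SIGNATURE-0): the (c3) row
and the pairing row are stated along `k ↦ φ k` for a strictly monotone `φ`; the radii `R (φ k) ≥ φ k + 1 ≥ k + 1` still diverge. [cite: Evans2010, §5.8.2 Theorem 3] -/
theorem hasWeakFDerivOn_of_blowDown_pairings_subseq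
    (hQ : IsOpen {x : EuclideanSpace ℝ (Fin 3) | ∀ i : Fin 3, |x i| < 1})
    (u : ℕ → Zd 3 → EuclideanSpace ℝ (Fin 4)) (z : ℕ → Zd 3) (R : ℕ → ℤ) (φ : ℕ → ℕ) (hφ : StrictMono φ)
    (hR : ∀ k : ℕ, (k : ℝ) + 1 ≤ R k) (hu : ∀ (k : ℕ) (y : Zd 3), ‖u k y‖ = 1)
    (U : EuclideanSpace ℝ (Fin 3) → EuclideanSpace ℝ (Fin 4))
    (hUm : AEStronglyMeasurable U (volume.restrict {x : EuclideanSpace ℝ (Fin 3) | ∀ i : Fin 3, |x i| < 1}))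
    (hU1 : ∀ᵐ x ∂(volume.restrict {x : EuclideanSpace ℝ (Fin 3) | ∀ i : Fin 3, |x i| < 1}), ‖U x‖ ≤ 1)
    (hL2 : Tendsto (fun k : ℕ => ∫ x in {x : EuclideanSpace ℝ (Fin 3) | ∀ i : Fin 3, |x i| < 1},
        ‖u (φ k) (z (φ k) + fun i => ⌊(R (φ k) : ℝ) * x i⌋) - U x‖ ^ 2) atTop (𝓝 0))
    (G : Fin 3 → EuclideanSpace ℝ (Fin 3) → EuclideanSpace ℝ (Fin 4))
    (hG : ∀ μ : Fin 3, IntegrableOn (G μ) {x : EuclideanSpace ℝ (Fin 3) | ∀ i : Fin 3, |x i| < 1} volume)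
    (hpair : ∀ (μ : Fin 3) (ψ : EuclideanSpace ℝ (Fin 3) → ℝ),
      IsTestFunctionOn ⟨{x : EuclideanSpace ℝ (Fin 3) | ∀ i : Fin 3, |x i| < 1}, hQ⟩ ψ →
      Tendsto (fun k : ℕ => ∫ x in {x : EuclideanSpace ℝ (Fin 3) | ∀ i : Fin 3, |x i| < 1},
          ψ x • ((R (φ k) : ℝ) • (u (φ k) ((z (φ k) + fun i => ⌊(R (φ k) : ℝ) * x i⌋) + unitVec μ)
            - u (φ k) (z (φ k) + fun i => ⌊(R (φ k) : ℝ) * x i⌋))))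
        atTop (𝓝 (∫ x in {x : EuclideanSpace ℝ (Fin 3) | ∀ i : Fin 3, |x i| < 1}, ψ x • G μ x))) :
    HasWeakFDerivOn ⟨{x : EuclideanSpace ℝ (Fin 3) | ∀ i : Fin 3, |x i| < 1}, hQ⟩ volume U
      (fun x => ∑ μ : Fin 3, (EuclideanSpace.proj μ).smulRight (G μ x)) := by
  refine hasWeakFDerivOn_of_blowDown_pairings hQ (fun k => u (φ k)) (fun k => z (φ k)) (fun k => R (φ k))
    (fun k => ?_) (fun k y => hu _ y) U hUm hU1 hL2 G hG hpair
  have h1 : (k : ℝ) ≤ (φ k : ℕ) := by exact_mod_cast hφ.id_le k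
  have h2 := hR (φ k)
  linarith

end Summit.QuantumFields.YangMills.Theorems.PoincareLipschitzBlowDownWeakGradient

end
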